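import Summits.QuantumFields.YangMills.Theorems.UnitScaleTiltProp7FrameCorrectedKernelSlice
import Summits.QuantumFields.YangMills.Theorems.UnitScaleTiltProp7TwistedSliceGaugeOntoSU2OfQSym
import Summits.QuantumFields.YangMills.Theorems.UnitScaleTiltProp7SliceChainOfPlaqSmall
import HarnessLib

/-!
# Route `UnitScaleTilt`, crux K1 child «MinimiserStabilityRegPr» (stmt-QuantumFields-19200), skeleton v10, stub `stub_existenceMinimalOrbit` (EX), route (α) —
# **«P2CORE-OF-PLAQSMALL, FILE B» (px16 g4 LOCATE-HSPLIT-DESCENT v1.1 ecde23f5, cure (C1′); EX namer ★w2-19200 g7 (29) GO): THE `U′`-REGULARITY HYPOTHESIS OF THE (P1) SLICE-ONTO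
# CHAIN WEAKENED FROM `RegPr ε₀′ U′` TO `PlaqSmall (regThreshold F n K ε₀′) U′`** — re-exports, with the SAME proofs, of T4 ✓`Prop7TwistedSliceGaugeOnto.fderiv_logChartTwS_sub_eq_zero_of_frameCorrected`
# + ✓`….exists_slice_tangent_add_gaugeDir_of_QSym_eq_zero` (★w4-20520), T5 ✓`Prop7TwistedSliceGaugeOntoTower.exists_slice_tangent_add_gaugeDir_of_QSym_eq_zero_of_tower` (★w5-20520),
# ✓`Prop7TowerClosenessOfRegPr.exists_slice_tangent_add_gaugeDir_of_QSym_eq_zero_of_regPr` (★px6), ✓`Prop7TwistedSliceGaugeOntoSU2.exists_su2_slice_tangent_add_gaugeDir_of_QSym_eq_zero` (★w4-20520)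
# and ROW-G ✓`Prop7FrameCorrectedKernelSlice.fderiv_logChartTwS_eq_zero_of_frameCorrected_eq_zero` (★px10) — statements VERBATIM except `hreg′ ↦ hplaq′` at the chart point `U′` (the
# background `U₀` keeps `RegPr`); the three places `hreg′` was read (T2's characterisation, the `U′`-based relative average and its gauge covariance) are served by ★px16 g3's (C1)
# ✓p682411 twins ✓`fderiv_logChartTwS_apply_eq_zero_iff_of_plaqSmall`, ✓`hasFDerivAt_rel_of_plaqSmall`, ✓`QSym_gaugeDir_of_plaqSmall`; NO landed declaration is edited.
# WHY (as FILE A ✓`Prop7FrameCorrectedMinusMean.towerData_of_plaqSmall`): [Balaban1985RegularSpaces] Sect. D reads only (1.7) of `U₁U₀`, and the EX display's (19)-size of the chart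
# exponent is available only through `hSplit[Lift]` itself, whereas `PlaqSmall` of the chart point follows from orders 0,1 — the descent `hSplit[Lift] ↦ ✓p671435` is acyclic in this currency.

Cell `ym3-torus`, width seat `ym3-torus-px16` (gen 4).  THEOREMS ONLY (0 `def`, 0 `sorry`); `--supports stmt-QuantumFields-19200 --as helper`, count-neutral.  YM₃ on T³ is a ladder rung
(R3), not the Clay problem; nothing here claims the stub, the crux, d = 4 or the mass gap.

References: T. Bałaban, CMP 98 (1985) 17–51 [Balaban1985Averaging] ((11) p.19, (97) p.32); CMP 99 (1985) 389–434 [Balaban1985BackgroundPropagators] ((3.13)–(3.15) p.393, (3.19) p.393,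
(3.21) p.394, (3.114)–(3.115) p.418); CMP 102 (1985) 277–309 [Balaban1985Variational] ((44)–(49) p.285, (51) p.286, (82)–(83) p.290); CMP 99 (1985) 75–102 [Balaban1985RegularSpaces]
((1.7)+(1.9) p.77, Sect. D pp.89–95).
-/

set_option autoImplicit false

noncomputable section

open scoped BigOperators Matrix.Norms.L2Operator Matrix Topology RightActions
open Filter NormedSpace Metric

namespace Summit.QuantumFields.YangMills.Theorems.Prop7SliceOntoOfPlaqSmall

open Literature.Analysis.Calculus.ExpDifferential (ad gSer)
open Literature.MathematicalPhysics.QuantumFieldTheory.Balaban1983to89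
open Literature.MathematicalPhysics.QuantumFieldTheory.Balaban1983to89.T3ContinuumYM3Torus
open T4Continuum BlockAveraging ExpMeanLog MatrixLog
open T3LevelShift (siteShift)
open T3PrintedRegularOrbits (sites_eq)
open T3SectALandauChart (bgUnits eta eta_pos)
open T3PrintedRegularMinimiser (RegPr)
open T3RegularMinimiser (regThreshold)
open B10Eq27TorusAxialLog (holT gaugeActT gaugeActT_apply transl)
open B7Prop1Explicit (expUnit val_expUnit disp)
open B15DeterminingSets (embIter)
open Summit.QuantumFields.YangMills.Theorems.Prop8Chart (emlIterU)
open Summit.QuantumFields.YangMills.Theorems.Prop7SymAvgGL (QSym descendToGL)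
open Summit.QuantumFields.YangMills.Theorems.Prop7SymAvgTwSym (tstairU vframeCovU frameAccU dbarCovIterU frameTwS frameTwS_def dbarTwS logChartTwS)
open Summit.QuantumFields.YangMills.Theorems.Prop7SymAvgTwGaugeDir (hasFDerivAt_logChartSym)
open Summit.QuantumFields.YangMills.Theorems.Prop7TwistedSliceTangent (hasFDerivAt_frameTwS_at_of_regPr)
open Summit.QuantumFields.YangMills.Theorems.Prop7ChartVelocityDexp (isUnit_gSer_ad_neg)
open Summit.QuantumFields.YangMills.Theorems.Prop7FrameResponseChartGlue (fderiv_frameTwS_apply_eq_of_chartCurve exists_chartCurve_of_gaugeDir)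
open Summit.QuantumFields.YangMills.Theorems.Prop7FrameLevelOnto (exists_frameCorrected_eq)
open Summit.QuantumFields.YangMills.Theorems.Prop7TwistedSliceGaugeOntoTower (eta_le_one exists_gaugeParam_frameCorrected_eq)
open Summit.QuantumFields.YangMills.Theorems.Prop7TowerClosenessOfRegPr (norm_tstairU_tower_sub_one_le_of_regPr norm_frameAccU_le_two_of_regPr norm_frameAccU_inv_le_two_of_regPr
  norm_vframeCovU_inv_le_two_of_regPr norm_loopH_sub_one_le_of_regPr norm_loopH_inv_sub_one_le_of_regPr)
open Summit.QuantumFields.YangMills.Theorems.Prop7TwistedSliceGaugeOntoSU2 (exists_su2_slice_tangent_add_gaugeDir_of_complex_of_regPr)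
open Summit.QuantumFields.YangMills.Theorems.Prop7FrameCorrectedKernelSlice (gaugeDir_velocity_unique)
open Summit.QuantumFields.YangMills.Theorems.Prop7SliceChainOfPlaqSmall (fderiv_logChartTwS_apply_eq_zero_iff_of_plaqSmall hasFDerivAt_rel_of_plaqSmall QSym_gaugeDir_of_plaqSmall)

variable (F : T3Family) {n K : ℕ} (h : n ≤ K)

/-- ★★★ **THE CONVERSE HALF OF THE `hsplit` TRANSPORT, GIVEN THE SOLVED FRAME-CORRECTED GAUGE EQUATION.**  In the setting of T2 §5, let `ξ ∈ ker QSym(U′)`, let `β₀` be its chart pre-velocity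
(`Mβ₀ = ξ`), and let the fine gauge parameter `N` with chart velocity `γ` (`Mγ = G_{U′}N`) solve `N(x̂_y) − λ_γ(y) = −λ_{β₀}(y)` at every comparison site `y` (`λ_α(y) = D(v(·)(y))(A₁)α·v(A₁)(y)⁻¹` the
frame response).  Then `β₀ − γ` is tangent to the twisted slice at `A₁`: `D(logChartTwS U₀)(A₁)(β₀ − γ) = 0`.  Proof: T2's characterisation for `β₀ − γ`; its left side is
`QSym U′ (ξ − G_{U′}N) = −(coarse gauge motion of N∘x̂)` (✓`QSym_gaugeDir_of_regPr`), its right side is the coarse gauge motion of `λ_{β₀} − λ_γ = −N∘x̂`.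
[cite: Balaban1985Averaging, (11) p.19, (97) p.32; Balaban1985BackgroundPropagators, (3.19) p.393, (3.114)-(3.115) p.418; Balaban1985Variational, (44)-(49) p.285] -/
theorem fderiv_logChartTwS_sub_eq_zero_of_frameCorrected_of_plaqSmall {ε₀ ε₀' e : ℝ} (hε₀ : 0 < ε₀) (he : 0 < e) (hWe : 10 ^ 9 * (F.L : ℝ) ^ 2 * e ≤ 1)
    (hWε : 10 ^ 12 * (F.L : ℝ) ^ 3 * ε₀ ≤ 1) (hε₀' : 0 < ε₀') (hε' : 10 ^ 7 * (F.L : ℝ) ^ 3 * ε₀' ≤ 1)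
    (U₀ U' : GaugeField (F.P K) 0 (Matrix.specialUnitaryGroup (Fin 2) ℂ)) (hreg : RegPr F n K ε₀ U₀) (hplaq' : PlaqSmall (regThreshold F n K ε₀') U')
    (A₁ : PBond (F.P K) 0 → Matrix (Fin 2) (Fin 2) ℂ) (hA₁ : ‖A₁‖ < e * eta F n K)
    (hU' : ∀ b, ((U' b : Matrix.specialUnitaryGroup (Fin 2) ℂ) : Matrix (Fin 2) (Fin 2) ℂ) = exp (A₁ b) * ((U₀ b : Matrix.specialUnitaryGroup (Fin 2) ℂ) : Matrix (Fin 2) (Fin 2) ℂ))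
    (ξ β₀ γ : PBond (F.P K) 0 → Matrix (Fin 2) (Fin 2) ℂ) (N : Site (F.P K) 0 → Matrix (Fin 2) (Fin 2) ℂ) (hξ : QSym F n K h U' ξ = 0)
    (hβ₀ : ∀ b, gSer ℂ (ad ℂ (-A₁ b)) (β₀ b) = ξ b)
    (hγ : ∀ b, gSer ℂ (ad ℂ (-A₁ b)) (γ b) = N b.src - ((bgUnits F K U' b : (Matrix (Fin 2) (Fin 2) ℂ)ˣ) : Matrix (Fin 2) (Fin 2) ℂ) * N b.tgt *
        (((bgUnits F K U' b)⁻¹ : (Matrix (Fin 2) (Fin 2) ℂ)ˣ) : Matrix (Fin 2) (Fin 2) ℂ))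
    (hN : ∀ y : Site (F.P n) 0, N (embIter (K - n) (siteShift (sites_eq F n K h) y))
        - fderiv ℂ (fun A : PBond (F.P K) 0 → Matrix (Fin 2) (Fin 2) ℂ => ((frameTwS F n K h U₀ A y : (Matrix (Fin 2) (Fin 2) ℂ)ˣ) : Matrix (Fin 2) (Fin 2) ℂ)) A₁ γ *
            (((frameTwS F n K h U₀ A₁ y)⁻¹ : (Matrix (Fin 2) (Fin 2) ℂ)ˣ) : Matrix (Fin 2) (Fin 2) ℂ)
        = -(fderiv ℂ (fun A : PBond (F.P K) 0 → Matrix (Fin 2) (Fin 2) ℂ => ((frameTwS F n K h U₀ A y : (Matrix (Fin 2) (Fin 2) ℂ)ˣ) : Matrix (Fin 2) (Fin 2) ℂ)) A₁ β₀ *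
            (((frameTwS F n K h U₀ A₁ y)⁻¹ : (Matrix (Fin 2) (Fin 2) ℂ)ˣ) : Matrix (Fin 2) (Fin 2) ℂ))) :
    fderiv ℂ (logChartTwS F n K h U₀) A₁ (β₀ - γ) = 0 := by
  apply (fderiv_logChartTwS_apply_eq_zero_iff_of_plaqSmall F h hε₀ he hWe hWε hε₀' hε' U₀ U' hreg hplaq' A₁ hA₁ hU' (β₀ - γ)).2
  intro c
  -- the velocity of `β₀ − γ` is `ξ − G_{U′}N`
  have hM : (fun b : PBond (F.P K) 0 => gSer ℂ (ad ℂ (-A₁ b)) ((β₀ - γ) b))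
      = ξ - fun b : PBond (F.P K) 0 => N b.src - ((bgUnits F K U' b : (Matrix (Fin 2) (Fin 2) ℂ)ˣ) : Matrix (Fin 2) (Fin 2) ℂ) * N b.tgt *
          (((bgUnits F K U' b)⁻¹ : (Matrix (Fin 2) (Fin 2) ℂ)ˣ) : Matrix (Fin 2) (Fin 2) ℂ) := by
    funext b
    rw [Pi.sub_apply, map_sub, hβ₀, hγ, Pi.sub_apply]
  -- `QSym U′` is the derivative of the `U′`-based relative average
  have hG := hasFDerivAt_rel_of_plaqSmall F h hε₀' hε' U' hplaq'
  have hQ : QSym F n K h U' = fderiv ℂ (fun A : PBond (F.P K) 0 → Matrix (Fin 2) (Fin 2) ℂ => fun c : PBond (F.P n) 0 =>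
        ((descendToGL F n K h (fun b => expUnit (A b) * bgUnits F K U' b) c : (Matrix (Fin 2) (Fin 2) ℂ)ˣ) : Matrix (Fin 2) (Fin 2) ℂ) *
          (((descendToGL F n K h (bgUnits F K U') c)⁻¹ : (Matrix (Fin 2) (Fin 2) ℂ)ˣ) : Matrix (Fin 2) (Fin 2) ℂ)) 0 :=
    (hasFDerivAt_logChartSym F h U' hG).fderiv
  have hgauge := QSym_gaugeDir_of_plaqSmall F h hε₀' hε' U' hplaq' N
  -- the frame responses are linear in the direction
  have hlin : ∀ y : Site (F.P n) 0,
      fderiv ℂ (fun A : PBond (F.P K) 0 → Matrix (Fin 2) (Fin 2) ℂ => ((frameTwS F n K h U₀ A y : (Matrix (Fin 2) (Fin 2) ℂ)ˣ) : Matrix (Fin 2) (Fin 2) ℂ)) A₁ (β₀ - γ) *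
          (((frameTwS F n K h U₀ A₁ y)⁻¹ : (Matrix (Fin 2) (Fin 2) ℂ)ˣ) : Matrix (Fin 2) (Fin 2) ℂ)
        = -N (embIter (K - n) (siteShift (sites_eq F n K h) y)) := by
    intro y
    rw [map_sub, sub_mul, sub_eq_iff_eq_add.mp (hN y)]
    abel
  rw [hM, ← hQ, map_sub, hξ, hgauge, zero_sub, Pi.neg_apply, hlin c.src, hlin c.tgt, neg_sub, sub_mul]
  simp only [mul_assoc, Units.inv_mul_cancel_left, neg_mul, mul_neg, sub_neg_eq_add]
  abel

/-- ★★★ **`hsplit`-SHAPED PACKAGING: `ker QSym(U′) ⊆ M·𝒯_{A₁} + 𝒢_{U′}` ONCE `𝓚_{A₁}(N) = −λ_{M⁻¹ξ}` IS SOLVED.**  In the setting of T2 §5: if `QSym U′ ξ = 0`, `Mβ₀ = ξ`, and some fine gauge parameter `N`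
with chart velocity `γ` (`Mγ = G_{U′}N`) solves the frame-corrected gauge equation `N(x̂_y) − λ_γ(y) = −λ_{β₀}(y)` at the comparison sites, then `ξ` splits as a twisted-slice-tangent velocity plus a
gauge direction at `U′`: `∃ β N, D(logChartTwS U₀)(A₁)β = 0 ∧ ξ = Mβ + G_{U′}N` (`β := β₀ − γ`).  The solvability hypothesis is print's «`Q′` maps onto the coarse gauge parameters» at the chart point;
at `A₁ = 0` the operator is the `k`-fold block Ad-average ([Balaban1985BackgroundPropagators] (3.19)), at `A₁ ≠ 0` its onto-ness is the located N06-class residue of the row.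
[cite: Balaban1985Averaging, (11) p.19, (97) p.32; Balaban1985BackgroundPropagators, (3.19) p.393, (3.21) p.394, (3.114)-(3.115) p.418; Balaban1985Variational, (44)-(49) p.285, (82)-(83) p.290] -/
theorem exists_slice_tangent_add_gaugeDir_of_QSym_eq_zero_of_plaqSmall {ε₀ ε₀' e : ℝ} (hε₀ : 0 < ε₀) (he : 0 < e) (hWe : 10 ^ 9 * (F.L : ℝ) ^ 2 * e ≤ 1)
    (hWε : 10 ^ 12 * (F.L : ℝ) ^ 3 * ε₀ ≤ 1) (hε₀' : 0 < ε₀') (hε' : 10 ^ 7 * (F.L : ℝ) ^ 3 * ε₀' ≤ 1)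
    (U₀ U' : GaugeField (F.P K) 0 (Matrix.specialUnitaryGroup (Fin 2) ℂ)) (hreg : RegPr F n K ε₀ U₀) (hplaq' : PlaqSmall (regThreshold F n K ε₀') U')
    (A₁ : PBond (F.P K) 0 → Matrix (Fin 2) (Fin 2) ℂ) (hA₁ : ‖A₁‖ < e * eta F n K)
    (hU' : ∀ b, ((U' b : Matrix.specialUnitaryGroup (Fin 2) ℂ) : Matrix (Fin 2) (Fin 2) ℂ) = exp (A₁ b) * ((U₀ b : Matrix.specialUnitaryGroup (Fin 2) ℂ) : Matrix (Fin 2) (Fin 2) ℂ))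
    (ξ β₀ : PBond (F.P K) 0 → Matrix (Fin 2) (Fin 2) ℂ) (hξ : QSym F n K h U' ξ = 0) (hβ₀ : ∀ b, gSer ℂ (ad ℂ (-A₁ b)) (β₀ b) = ξ b)
    (hK : ∃ (N : Site (F.P K) 0 → Matrix (Fin 2) (Fin 2) ℂ) (γ : PBond (F.P K) 0 → Matrix (Fin 2) (Fin 2) ℂ),
      (∀ b, gSer ℂ (ad ℂ (-A₁ b)) (γ b) = N b.src - ((bgUnits F K U' b : (Matrix (Fin 2) (Fin 2) ℂ)ˣ) : Matrix (Fin 2) (Fin 2) ℂ) * N b.tgt *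
          (((bgUnits F K U' b)⁻¹ : (Matrix (Fin 2) (Fin 2) ℂ)ˣ) : Matrix (Fin 2) (Fin 2) ℂ)) ∧
      ∀ y : Site (F.P n) 0, N (embIter (K - n) (siteShift (sites_eq F n K h) y))
          - fderiv ℂ (fun A : PBond (F.P K) 0 → Matrix (Fin 2) (Fin 2) ℂ => ((frameTwS F n K h U₀ A y : (Matrix (Fin 2) (Fin 2) ℂ)ˣ) : Matrix (Fin 2) (Fin 2) ℂ)) A₁ γ *
              (((frameTwS F n K h U₀ A₁ y)⁻¹ : (Matrix (Fin 2) (Fin 2) ℂ)ˣ) : Matrix (Fin 2) (Fin 2) ℂ)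
          = -(fderiv ℂ (fun A : PBond (F.P K) 0 → Matrix (Fin 2) (Fin 2) ℂ => ((frameTwS F n K h U₀ A y : (Matrix (Fin 2) (Fin 2) ℂ)ˣ) : Matrix (Fin 2) (Fin 2) ℂ)) A₁ β₀ *
              (((frameTwS F n K h U₀ A₁ y)⁻¹ : (Matrix (Fin 2) (Fin 2) ℂ)ˣ) : Matrix (Fin 2) (Fin 2) ℂ))) :
    ∃ (β : PBond (F.P K) 0 → Matrix (Fin 2) (Fin 2) ℂ) (N : Site (F.P K) 0 → Matrix (Fin 2) (Fin 2) ℂ),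
      fderiv ℂ (logChartTwS F n K h U₀) A₁ β = 0 ∧
      ∀ b, ξ b = gSer ℂ (ad ℂ (-A₁ b)) (β b) + (N b.src - ((bgUnits F K U' b : (Matrix (Fin 2) (Fin 2) ℂ)ˣ) : Matrix (Fin 2) (Fin 2) ℂ) * N b.tgt *
          (((bgUnits F K U' b)⁻¹ : (Matrix (Fin 2) (Fin 2) ℂ)ˣ) : Matrix (Fin 2) (Fin 2) ℂ)) := by
  obtain ⟨N, γ, hγ, hN⟩ := hK
  refine ⟨β₀ - γ, N, fderiv_logChartTwS_sub_eq_zero_of_frameCorrected_of_plaqSmall F h hε₀ he hWe hWε hε₀' hε' U₀ U' hreg hplaq' A₁ hA₁ hU' ξ β₀ γ N hξ hβ₀ hγ hN, fun b => ?_⟩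
  rw [Pi.sub_apply, map_sub, hβ₀, hγ, sub_add_cancel]

/-- ★★★ **(P1) OF `hSplitD`: `ker QSym(U′) ⊆ M·𝒯_{A₁} + 𝒢_{U′}` AT THE CHART POINT, FROM THE TOWER.**  In the setting of T2 §5 (`U₀ ∈ 𝔘_k(ε₀)`, `U′ = e^{A₁}U₀ ∈ 𝔘_k(ε₀′)`,
`10¹²L³ε₀ ≤ 1`, `10⁹L²e ≤ 1`, `10⁷L³ε₀′ ≤ 1`, `‖A₁‖ < e·η`) with the comparison tower of `(U₀♭, U′♭)` `δ`-close below the top level (`δ ≤ 1/200`, gauge-invariant letters): every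
`ξ ∈ ker QSym(U′)` splits as **`ξ = Mβ + G_{U′}N` with `D(logChartTwS U₀)(A₁)β = 0`** — a twisted-slice-TANGENT velocity plus a gauge direction at `U′`.  Proof: invert `M` bondwise
(✓`isUnit_gSer_ad_neg`), solve the frame-corrected equation with right side `−λ_{M⁻¹ξ}` by the previous theorem, and apply ✓T4 `exists_slice_tangent_add_gaugeDir_of_QSym_eq_zero`.  With ✓T3
(the converse inclusion) this is `M(𝒯_{A₁}) + 𝒢_{U′} = ker QSym(U′) + 𝒢_{U′}` at the chart point; what remains of `hSplitD` is (P2) (Landau transversality at the chart point), the 𝔰𝔲(2)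
bookkeeping, and the tower-closeness letter from `RegPr`. [cite: Balaban1985Averaging, (11) p.19, (97) p.32; Balaban1985BackgroundPropagators, (3.19) p.393, (3.21) p.394, (3.114)-(3.115) p.418; Balaban1985Variational, (44)-(49) p.285, (82)-(83) p.290] -/
theorem exists_slice_tangent_add_gaugeDir_of_QSym_eq_zero_of_tower_of_plaqSmall {ε₀ ε₀' e : ℝ} (hε₀ : 0 < ε₀) (he : 0 < e) (hWe : 10 ^ 9 * (F.L : ℝ) ^ 2 * e ≤ 1)
    (hWε : 10 ^ 12 * (F.L : ℝ) ^ 3 * ε₀ ≤ 1) (hε₀' : 0 < ε₀') (hε' : 10 ^ 7 * (F.L : ℝ) ^ 3 * ε₀' ≤ 1)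
    (U₀ U' : GaugeField (F.P K) 0 (Matrix.specialUnitaryGroup (Fin 2) ℂ)) (hreg : RegPr F n K ε₀ U₀) (hplaq' : PlaqSmall (regThreshold F n K ε₀') U')
    (A₁ : PBond (F.P K) 0 → Matrix (Fin 2) (Fin 2) ℂ) (hA₁ : ‖A₁‖ < e * eta F n K)
    (hU' : ∀ b, ((U' b : Matrix.specialUnitaryGroup (Fin 2) ℂ) : Matrix (Fin 2) (Fin 2) ℂ) = exp (A₁ b) * ((U₀ b : Matrix.specialUnitaryGroup (Fin 2) ℂ) : Matrix (Fin 2) (Fin 2) ℂ))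
    {δ : ℝ} (hδ0 : 0 ≤ δ) (hδ : δ ≤ 1 / 200)
    (hτ : ∀ (j : ℕ) (y : Site (F.P K) (j + 1)),
      j < K - n → ‖(fun i : Idx (F.P K) => ((tstairU (emlIterU j (bgUnits F K U₀)) (dbarCovIterU j (bgUnits F K U₀) (bgUnits F K U')) y i : (Matrix (Fin 2) (Fin 2) ℂ)ˣ) : Matrix (Fin 2) (Fin 2) ℂ)) - 1‖ ≤ δ)
    (hν : ∀ (j : ℕ) (x : Site (F.P K) j), j < K - n → ‖((frameAccU j (bgUnits F K U₀) (bgUnits F K U') x : (Matrix (Fin 2) (Fin 2) ℂ)ˣ) : Matrix (Fin 2) (Fin 2) ℂ)‖ ≤ 2)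
    (hν' : ∀ (j : ℕ) (x : Site (F.P K) j), j < K - n → ‖(((frameAccU j (bgUnits F K U₀) (bgUnits F K U') x)⁻¹ : (Matrix (Fin 2) (Fin 2) ℂ)ˣ) : Matrix (Fin 2) (Fin 2) ℂ)‖ ≤ 2)
    (hw : ∀ (j : ℕ) (y : Site (F.P K) (j + 1)),
      j < K - n → ‖(((vframeCovU (emlIterU j (bgUnits F K U₀)) (dbarCovIterU j (bgUnits F K U₀) (bgUnits F K U')) y)⁻¹ : (Matrix (Fin 2) (Fin 2) ℂ)ˣ) : Matrix (Fin 2) (Fin 2) ℂ)‖ ≤ 2)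
    (hH : ∀ (j : ℕ) (y : Site (F.P K) (j + 1)) (i : Idx (F.P K)), j < K - n → ‖((((frameAccU j (bgUnits F K U₀) (bgUnits F K U') (emb y) * holT (dbarCovIterU j (bgUnits F K U₀) (bgUnits F K U')) (emb y) (stairWord i.2.1 (off i.1)) * (frameAccU j (bgUnits F K U₀) (bgUnits F K U') (transl (emb y) (disp (stairWord i.2.1 (off i.1)))))⁻¹) * (frameAccU j (bgUnits F K U₀) (bgUnits F K U') (emb y) * holT (dbarCovIterU j (bgUnits F K U₀) (bgUnits F K U')) (emb y) (stairWord (1 : Equiv.Perm (Fin (F.P K).d)) (off i.1)) * (frameAccU j (bgUnits F K U₀) (bgUnits F K U') (transl (emb y) (disp (stairWord (1 : Equiv.Perm (Fin (F.P K).d)) (off i.1)))))⁻¹)⁻¹ * (frameAccU j (bgUnits F K U₀) (bgUnits F K U') (emb y) * holT (dbarCovIterU j (bgUnits F K U₀) (bgUnits F K U')) (emb y) (stairWord (1 : Equiv.Perm (Fin (F.P K).d)) (off (fun _ : Fin (F.P K).d => (⟨((F.P K).L - 1) / 2, by have := (F.P K).L_pos; omega⟩ : Fin (F.P K).L)))) *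 (frameAccU j (bgUnits F K U₀) (bgUnits F K U') (transl (emb y) (disp (stairWord (1 : Equiv.Perm (Fin (F.P K).d)) (off (fun _ : Fin (F.P K).d => (⟨((F.P K).L - 1) / 2, by have := (F.P K).L_pos; omega⟩ : Fin (F.P K).L)))))))⁻¹)) : (Matrix (Fin 2) (Fin 2) ℂ)ˣ) : Matrix (Fin 2) (Fin 2) ℂ) - 1‖ ≤ δ)
    (hH' : ∀ (j : ℕ) (y : Site (F.P K) (j + 1)) (i : Idx (F.P K)), j < K - n → ‖((((frameAccU j (bgUnits F K U₀) (bgUnits F K U') (emb y) * holT (dbarCovIterU j (bgUnits F K U₀) (bgUnits F K U')) (emb y) (stairWord i.2.1 (off i.1)) * (frameAccU j (bgUnits F K U₀) (bgUnits F K U') (transl (emb y) (disp (stairWord i.2.1 (off i.1)))))⁻¹) * (frameAccU j (bgUnits F K U₀) (bgUnits F K U') (emb y) * holT (dbarCovIterU j (bgUnits F K U₀) (bgUnits F K U')) (emb y) (stairWord (1 : Equiv.Perm (Fin (F.P K).d)) (off i.1)) * (frameAccU j (bgUnits F K U₀) (bgUnits F K U') (transl (emb y) (disp (stairWord (1 :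 Equiv.Perm (Fin (F.P K).d)) (off i.1)))))⁻¹)⁻¹ * (frameAccU j (bgUnits F K U₀) (bgUnits F K U') (emb y) * holT (dbarCovIterU j (bgUnits F K U₀) (bgUnits F K U')) (emb y) (stairWord (1 : Equiv.Perm (Fin (F.P K).d)) (off (fun _ : Fin (F.P K).d => (⟨((F.P K).L - 1) / 2, by have := (F.P K).L_pos; omega⟩ : Fin (F.P K).L)))) * (frameAccU j (bgUnits F K U₀) (bgUnits F K U') (transl (emb y) (disp (stairWord (1 : Equiv.Perm (Fin (F.P K).d)) (off (fun _ : Fin (F.P K).d => (⟨((F.P K).L - 1) / 2, by have := (F.P K).L_pos; omega⟩ : Fin (F.P K).L)))))))⁻¹))⁻¹ : (Matrix (Fin 2) (Fin 2) ℂ)ˣ) : Matrix (Fin 2) (Fin 2) ℂ) - 1‖ ≤ δ)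
    (ξ : PBond (F.P K) 0 → Matrix (Fin 2) (Fin 2) ℂ) (hξ : QSym F n K h U' ξ = 0) :
    ∃ (β : PBond (F.P K) 0 → Matrix (Fin 2) (Fin 2) ℂ) (N : Site (F.P K) 0 → Matrix (Fin 2) (Fin 2) ℂ),
      fderiv ℂ (logChartTwS F n K h U₀) A₁ β = 0 ∧
      ∀ b, ξ b = gSer ℂ (ad ℂ (-A₁ b)) (β b) + (N b.src - ((bgUnits F K U' b : (Matrix (Fin 2) (Fin 2) ℂ)ˣ) : Matrix (Fin 2) (Fin 2) ℂ) * N b.tgt *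
          (((bgUnits F K U' b)⁻¹ : (Matrix (Fin 2) (Fin 2) ℂ)ˣ) : Matrix (Fin 2) (Fin 2) ℂ)) := by
  -- invert the velocity map bondwise to get the chart pre-velocity of `ξ`
  have hL1 : (1 : ℝ) ≤ (F.L : ℝ) := by exact_mod_cast F.hL.2.le
  have hA₁b : ∀ b, ‖A₁ b‖ ≤ e * eta F n K := fun b => (norm_le_pi_norm A₁ b).trans hA₁.le
  have hA₁2 : ∀ b, ‖A₁ b‖ ≤ 1 / 2 := fun b => (hA₁b b).trans (by nlinarith [eta_le_one F (n := n) (K := K), eta_pos F (n := n) (K := K), he.le])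
  have hM : ∀ b, IsUnit (gSer ℂ (ad ℂ (-A₁ b))) := fun b => isUnit_gSer_ad_neg (hA₁2 b)
  set β₀ : PBond (F.P K) 0 → Matrix (Fin 2) (Fin 2) ℂ := fun b => (((hM b).unit⁻¹ : (Matrix (Fin 2) (Fin 2) ℂ →L[ℂ] Matrix (Fin 2) (Fin 2) ℂ)ˣ) :
    Matrix (Fin 2) (Fin 2) ℂ →L[ℂ] Matrix (Fin 2) (Fin 2) ℂ) (ξ b) with hβ₀
  have hβ₀M : ∀ b, gSer ℂ (ad ℂ (-A₁ b)) (β₀ b) = ξ b := by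
    intro b
    have h1 : gSer ℂ (ad ℂ (-A₁ b)) = (((hM b).unit : (Matrix (Fin 2) (Fin 2) ℂ →L[ℂ] Matrix (Fin 2) (Fin 2) ℂ)ˣ) : Matrix (Fin 2) (Fin 2) ℂ →L[ℂ] Matrix (Fin 2) (Fin 2) ℂ) :=
      (hM b).unit_spec.symm
    rw [h1, hβ₀]
    show (((hM b).unit * (hM b).unit⁻¹ : (Matrix (Fin 2) (Fin 2) ℂ →L[ℂ] Matrix (Fin 2) (Fin 2) ℂ)ˣ) : Matrix (Fin 2) (Fin 2) ℂ →L[ℂ] Matrix (Fin 2) (Fin 2) ℂ) (ξ b) = ξ b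
    rw [mul_inv_cancel]
    rfl
  -- the tower solves the frame-corrected equation with right side `−λ_{β₀}`
  obtain ⟨N, γ, hγ, hN⟩ := exists_gaugeParam_frameCorrected_eq F h hε₀ he hWe hWε U₀ U' hreg A₁ hA₁ hU' hδ0 hδ hτ hν hν' hw hH hH'
    (fun y => -(fderiv ℂ (fun A : PBond (F.P K) 0 → Matrix (Fin 2) (Fin 2) ℂ => ((frameTwS F n K h U₀ A y : (Matrix (Fin 2) (Fin 2) ℂ)ˣ) : Matrix (Fin 2) (Fin 2) ℂ)) A₁ β₀ *
      (((frameTwS F n K h U₀ A₁ y)⁻¹ : (Matrix (Fin 2) (Fin 2) ℂ)ˣ) : Matrix (Fin 2) (Fin 2) ℂ)))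
  exact exists_slice_tangent_add_gaugeDir_of_QSym_eq_zero_of_plaqSmall F h hε₀ he hWe hWε hε₀' hε' U₀ U' hreg hplaq' A₁ hA₁ hU' ξ β₀ hξ hβ₀M ⟨N, γ, hγ, hN⟩

/-- ★★★ **(P1) OF `hSplitD` AT THE CHART POINT FROM `RegPr` ALONE: `ker QSym(U′) ⊆ M·𝒯_{A₁} + 𝒢_{U′}`** — ✓`Prop7TwistedSliceGaugeOntoTower.exists_slice_tangent_add_gaugeDir_of_QSym_eq_zero_of_tower`
(T5 B) with its six tower-closeness rows DISCHARGED (`δ := 1∕200`): in the setting of T2 §5 (`U₀ ∈ 𝔘_k(ε₀)`, `U′ = e^{A₁}U₀ ∈ 𝔘_k(ε₀′)`, `10¹²L³ε₀ ≤ 1`, `10⁹L²e ≤ 1`, `10⁷L³ε₀′ ≤ 1`,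
`‖A₁‖ < e·η`) every `ξ ∈ ker QSym(U′)` splits as `ξ = Mβ + G_{U′}N` with `D(logChartTwS U₀)(A₁)β = 0`.  (`U′`'s plaquette regularity `hplaq'` is T4's input, not the tower's.)  What remains of `hSplitD`:
(P2) (Landau transversality at the chart point) and the 𝔰𝔲(2) bookkeeping (★w4-20520 g6's ✓`…TwistedSliceGaugeOntoSU2`). [cite: Balaban1985Averaging, (11) p.19, (97) p.32;
Balaban1985BackgroundPropagators, (3.19) p.393, (3.114)-(3.115) p.418; Balaban1985Variational, (44)-(49) p.285, (82)-(83) p.290] -/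
theorem exists_slice_tangent_add_gaugeDir_of_QSym_eq_zero_of_regPr_of_plaqSmall {ε₀ ε₀' e : ℝ} (hε₀ : 0 < ε₀) (he : 0 < e) (hWe : 10 ^ 9 * (F.L : ℝ) ^ 2 * e ≤ 1)
    (hWε : 10 ^ 12 * (F.L : ℝ) ^ 3 * ε₀ ≤ 1) (hε₀' : 0 < ε₀') (hε' : 10 ^ 7 * (F.L : ℝ) ^ 3 * ε₀' ≤ 1)
    (U₀ U' : GaugeField (F.P K) 0 (Matrix.specialUnitaryGroup (Fin 2) ℂ)) (hreg : RegPr F n K ε₀ U₀) (hplaq' : PlaqSmall (regThreshold F n K ε₀') U')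
    (A₁ : PBond (F.P K) 0 → Matrix (Fin 2) (Fin 2) ℂ) (hA₁ : ‖A₁‖ < e * eta F n K)
    (hU' : ∀ b, ((U' b : Matrix.specialUnitaryGroup (Fin 2) ℂ) : Matrix (Fin 2) (Fin 2) ℂ) = exp (A₁ b) * ((U₀ b : Matrix.specialUnitaryGroup (Fin 2) ℂ) : Matrix (Fin 2) (Fin 2) ℂ))
    (ξ : PBond (F.P K) 0 → Matrix (Fin 2) (Fin 2) ℂ) (hξ : QSym F n K h U' ξ = 0) :
    ∃ (β : PBond (F.P K) 0 → Matrix (Fin 2) (Fin 2) ℂ) (N : Site (F.P K) 0 → Matrix (Fin 2) (Fin 2) ℂ),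
      fderiv ℂ (logChartTwS F n K h U₀) A₁ β = 0 ∧
      ∀ b, ξ b = gSer ℂ (ad ℂ (-A₁ b)) (β b) + (N b.src - ((bgUnits F K U' b : (Matrix (Fin 2) (Fin 2) ℂ)ˣ) : Matrix (Fin 2) (Fin 2) ℂ) * N b.tgt *
          (((bgUnits F K U' b)⁻¹ : (Matrix (Fin 2) (Fin 2) ℂ)ˣ) : Matrix (Fin 2) (Fin 2) ℂ)) :=
  exists_slice_tangent_add_gaugeDir_of_QSym_eq_zero_of_tower_of_plaqSmall F h hε₀ he hWe hWε hε₀' hε' U₀ U' hreg hplaq' A₁ hA₁ hU' (δ := 1 / 200) (by norm_num) le_rfl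
    (norm_tstairU_tower_sub_one_le_of_regPr F hε₀ he hWe hWε U₀ U' hreg A₁ hA₁ hU') (norm_frameAccU_le_two_of_regPr F hε₀ he hWe hWε U₀ U' hreg A₁ hA₁ hU')
    (norm_frameAccU_inv_le_two_of_regPr F hε₀ he hWe hWε U₀ U' hreg A₁ hA₁ hU') (norm_vframeCovU_inv_le_two_of_regPr F hε₀ he hWe hWε U₀ U' hreg A₁ hA₁ hU')
    (norm_loopH_sub_one_le_of_regPr F hε₀ he hWe hWε U₀ U' hreg A₁ hA₁ hU') (norm_loopH_inv_sub_one_le_of_regPr F hε₀ he hWe hWε U₀ U' hreg A₁ hA₁ hU') ξ hξ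

/-- ★★★ **THE (P1) SIDE OF `hSplitD` IN `𝔰𝔲(2)` CURRENCY FROM PRINTED-REGULAR DATA ONLY.**  At `U₀ ∈ 𝔘_k(ε₀)`, `U′ ∈ 𝔘_k(ε₀′)` with `U′(b) = e^{A₁(b)}U₀(b)`, `A₁` skew-Hermitian
traceless, `‖A₁‖ < e·η` (`10⁹L²e ≤ 1`, `10¹²L³ε₀ ≤ 1`, `10⁷L³ε₀′ ≤ 1`): every skew-Hermitian traceless `ξ` with `QSym(U′)ξ = 0` is
`ξ(b) = g(ad(−A₁ b))(β′ b) + (i·N′(b₋) − U′(b)·(i·N′(b₊))·U′(b)⋆)` with `β′` skew-Hermitian traceless, `D(logChartTwS U₀)(A₁)β′ = 0`, `N′` Hermitian traceless —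
★px6 g0's ✓`exists_slice_tangent_add_gaugeDir_of_QSym_eq_zero_of_regPr` (complex pair, tower rows discharged) followed by ✓`exists_su2_slice_tangent_add_gaugeDir_of_complex_of_regPr`.
[cite: Balaban1985Variational, (51) p.286, (82)-(83) p.290; Balaban1985Averaging, (11) p.19, (97) p.32; Balaban1985BackgroundPropagators, (3.13)-(3.15) p.393] -/
theorem exists_su2_slice_tangent_add_gaugeDir_of_QSym_eq_zero_of_plaqSmall {ε₀ ε₀' e : ℝ} (hε₀ : 0 < ε₀) (he : 0 < e) (hWe : 10 ^ 9 * (F.L : ℝ) ^ 2 * e ≤ 1)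
    (hWε : 10 ^ 12 * (F.L : ℝ) ^ 3 * ε₀ ≤ 1) (hε₀' : 0 < ε₀') (hε' : 10 ^ 7 * (F.L : ℝ) ^ 3 * ε₀' ≤ 1)
    (U₀ U' : GaugeField (F.P K) 0 (Matrix.specialUnitaryGroup (Fin 2) ℂ)) (hreg : RegPr F n K ε₀ U₀) (hplaq' : PlaqSmall (regThreshold F n K ε₀') U')
    (A₁ : PBond (F.P K) 0 → Matrix (Fin 2) (Fin 2) ℂ) (hA₁ : ‖A₁‖ < e * eta F n K) (hA₁R : ∀ b, star (A₁ b) = -A₁ b ∧ (A₁ b).trace = 0)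
    (hU' : ∀ b, ((U' b : Matrix.specialUnitaryGroup (Fin 2) ℂ) : Matrix (Fin 2) (Fin 2) ℂ) = exp (A₁ b) * ((U₀ b : Matrix.specialUnitaryGroup (Fin 2) ℂ) : Matrix (Fin 2) (Fin 2) ℂ))
    (ξ : PBond (F.P K) 0 → Matrix (Fin 2) (Fin 2) ℂ) (hξR : ∀ b, star (ξ b) = -ξ b ∧ (ξ b).trace = 0) (hξ : QSym F n K h U' ξ = 0) :
    ∃ β' : PBond (F.P K) 0 → Matrix (Fin 2) (Fin 2) ℂ, (∀ b, star (β' b) = -β' b ∧ (β' b).trace = 0) ∧ fderiv ℂ (logChartTwS F n K h U₀) A₁ β' = 0 ∧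
      ∃ N' : Site (F.P K) 0 → Matrix (Fin 2) (Fin 2) ℂ, (∀ x, (N' x).IsHermitian ∧ (N' x).trace = 0) ∧
        ∀ b : PBond (F.P K) 0, ξ b = gSer ℂ (ad ℂ (-A₁ b)) (β' b)
          + (Complex.I • N' b.src - ((U' b : Matrix.specialUnitaryGroup (Fin 2) ℂ) : Matrix (Fin 2) (Fin 2) ℂ) * (Complex.I • N' b.tgt)
              * star ((U' b : Matrix.specialUnitaryGroup (Fin 2) ℂ) : Matrix (Fin 2) (Fin 2) ℂ)) := by
  obtain ⟨β, N, hβ, hsplit⟩ := exists_slice_tangent_add_gaugeDir_of_QSym_eq_zero_of_regPr_of_plaqSmall F h hε₀ he hWe hWε hε₀' hε' U₀ U' hreg hplaq' A₁ hA₁ hU' ξ hξ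
  exact exists_su2_slice_tangent_add_gaugeDir_of_complex_of_regPr F h hε₀ he hWe hWε U₀ hreg hA₁ hA₁R U' ξ hξR β N hβ hsplit

/-- ★★★ **ROW-G: `𝓚_{A₁}N′ = 0 ⟹ D(logChartTwS U₀)(A₁)(M⁻¹G_{U′}N′) = 0`.**  In T2 §5's setting (`U₀ ∈ 𝔘_k(ε₀)`, `U′ = e^{A₁}U₀ ∈ 𝔘_k(ε₀′)`, `10¹²L³ε₀ ≤ 1`, `10⁹L²e ≤ 1`, `10⁷L³ε₀′ ≤ 1`,
`‖A₁‖ < e·η`): let `N′` be a fine gauge parameter, `V` the real derivative of the accumulated frames `t ↦ v_k(U₀♭, (U′♭)^{exp(tN′)})(x)` at `t = 0` (GAUGE-side letter of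
✓`Prop7FrameLevelOnto.exists_frameCorrected_eq`), and suppose the frame-corrected response VANISHES, `N′(x̂⁽ᵏ⁾x) − V(x)·v_k(U₀♭,U′♭)(x)⁻¹ = 0` at every top site `x`; let `w` be the chart velocity of
the gauge direction (`g(ad(−A₁(b)))w(b) = N′(b₋) − U′♭(b)N′(b₊)U′♭(b)⁻¹`).  Then `D(logChartTwS U₀)(A₁) w = 0`.  Proof: the chart curve of the orbit (GLUE §2) has velocity `w` (uniqueness),
GLUE §1 turns `V` into the complex frame response `D(v(·)(y))(A₁)w`, and ✓T4 at `ξ = β₀ = 0` concludes. [cite: Balaban1985Averaging, (11) p.19, (97) p.32; Balaban1985BackgroundPropagators, (3.19) p.393, (3.114)-(3.115) p.418; Balaban1985Variational, (44)-(49) p.285] -/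
theorem fderiv_logChartTwS_eq_zero_of_frameCorrected_eq_zero_of_plaqSmall {ε₀ ε₀' e : ℝ} (hε₀ : 0 < ε₀) (he : 0 < e) (hWe : 10 ^ 9 * (F.L : ℝ) ^ 2 * e ≤ 1)
    (hWε : 10 ^ 12 * (F.L : ℝ) ^ 3 * ε₀ ≤ 1) (hε₀' : 0 < ε₀') (hε' : 10 ^ 7 * (F.L : ℝ) ^ 3 * ε₀' ≤ 1)
    (U₀ U' : GaugeField (F.P K) 0 (Matrix.specialUnitaryGroup (Fin 2) ℂ)) (hreg : RegPr F n K ε₀ U₀) (hplaq' : PlaqSmall (regThreshold F n K ε₀') U')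
    (A₁ : PBond (F.P K) 0 → Matrix (Fin 2) (Fin 2) ℂ) (hA₁ : ‖A₁‖ < e * eta F n K)
    (hU' : ∀ b, ((U' b : Matrix.specialUnitaryGroup (Fin 2) ℂ) : Matrix (Fin 2) (Fin 2) ℂ) = exp (A₁ b) * ((U₀ b : Matrix.specialUnitaryGroup (Fin 2) ℂ) : Matrix (Fin 2) (Fin 2) ℂ))
    (N' : Site (F.P K) 0 → Matrix (Fin 2) (Fin 2) ℂ) (V : Site (F.P K) (K - n) → Matrix (Fin 2) (Fin 2) ℂ)
    (hV : ∀ x : Site (F.P K) (K - n), HasDerivAt (fun t : ℝ =>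
      ((frameAccU (K - n) (bgUnits F K U₀) (gaugeActT (fun z : Site (F.P K) 0 => expUnit (t • N' z)) (bgUnits F K U')) x : (Matrix (Fin 2) (Fin 2) ℂ)ˣ) : Matrix (Fin 2) (Fin 2) ℂ)) (V x) 0)
    (hK0 : ∀ x : Site (F.P K) (K - n), N' (embIter (K - n) x) - V x * (((frameAccU (K - n) (bgUnits F K U₀) (bgUnits F K U') x)⁻¹ : (Matrix (Fin 2) (Fin 2) ℂ)ˣ) : Matrix (Fin 2) (Fin 2) ℂ) = 0)
    (w : PBond (F.P K) 0 → Matrix (Fin 2) (Fin 2) ℂ)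
    (hw : ∀ b, gSer ℂ (ad ℂ (-A₁ b)) (w b) = N' b.src - ((bgUnits F K U' b : (Matrix (Fin 2) (Fin 2) ℂ)ˣ) : Matrix (Fin 2) (Fin 2) ℂ) * N' b.tgt *
        (((bgUnits F K U' b)⁻¹ : (Matrix (Fin 2) (Fin 2) ℂ)ˣ) : Matrix (Fin 2) (Fin 2) ℂ)) :
    fderiv ℂ (logChartTwS F n K h U₀) A₁ w = 0 := by
  -- sizes
  have hL1 : (1 : ℝ) ≤ (F.L : ℝ) := by exact_mod_cast F.hL.2.le
  have hA₁b : ∀ b, ‖A₁ b‖ ≤ e * eta F n K := fun b => (norm_le_pi_norm A₁ b).trans hA₁.le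
  have hA₁5 : ∀ b, ‖A₁ b‖ ≤ 1 / 5 := fun b => (hA₁b b).trans (by nlinarith [eta_le_one F (n := n) (K := K), eta_pos F (n := n) (K := K), he.le])
  have hA₁2 : ∀ b, ‖A₁ b‖ ≤ 1 / 2 := fun b => (hA₁5 b).trans (by norm_num)
  -- the configuration `e^{A₁}U₀♭ = U′♭`
  have hcfg : (fun b : PBond (F.P K) 0 => expUnit (A₁ b) * bgUnits F K U₀ b) = bgUnits F K U' := by
    funext b; apply Units.ext; rw [Units.val_mul, val_expUnit]; exact (hU' b).symm
  -- the chart curve of the orbit; its velocity is `w`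
  obtain ⟨c, γ, hc0, hcd, hγ, hcg⟩ := exists_chartCurve_of_gaugeDir F U₀ U' A₁ hA₁5 hU' N'
  have hγw : γ = w := gaugeDir_velocity_unique F A₁ hA₁2 γ w fun b => by rw [hγ b, hw b]
  subst hγw
  -- T4 at `ξ = β₀ = 0`
  have hT := fderiv_logChartTwS_sub_eq_zero_of_frameCorrected_of_plaqSmall F h hε₀ he hWe hWε hε₀' hε' U₀ U' hreg hplaq' A₁ hA₁ hU' 0 0 γ N' (map_zero _)
    (fun b => by simp only [Pi.zero_apply, map_zero]) hγ (fun y => ?_)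
  · rwa [zero_sub, map_neg, neg_eq_zero] at hT
  · -- the frame-corrected equation at the comparison site `y`, read through the glue
    have hΦ := (hasFDerivAt_frameTwS_at_of_regPr F h hε₀ he hWe hWε U₀ hreg hA₁b y).differentiableAt
    have hVy := fderiv_frameTwS_apply_eq_of_chartCurve F h U₀ U' A₁ y hΦ hc0 hcd hcg (hV (siteShift (sites_eq F n K h) y))
    have hfr : frameTwS F n K h U₀ A₁ y = frameAccU (K - n) (bgUnits F K U₀) (bgUnits F K U') (siteShift (sites_eq F n K h) y) := by
      rw [frameTwS_def, hcfg]
    rw [hVy, hfr, hK0, map_zero, zero_mul, neg_zero]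

end Summit.QuantumFields.YangMills.Theorems.Prop7SliceOntoOfPlaqSmall

end
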